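import Summits.AnomalousDissipation.AnomalousDissipation.Theorems.EnsembleRigidityGPStatisticalRigidityGpSmallEnergy
import Literature.Analysis.FunctionSpaces.TorusVectorParseval
import Literature.Analysis.FunctionSpaces.TorusSpectralWeakDerivative
import Literature.Analysis.FluidPDE.StatisticalSolutionProofs
import Literature.Analysis.FluidPDE.TorusLpOperatorFactsCommutatorProofs
import HarnessLib

/-!
# Stub `stub_gpParityForm` of line `Sketch` (crux stmt-AnomalousDissipation-17938, `EnsembleRigidity.GPTameDefectFloor`) — the parity enstrophy certificate of `f_GP`

For the Galloway–Proctor force `f_GP = (sin 2πx₂, sin 2πx₀, sin 2πx₁)` on `T³` and every field `v`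
of the energy space `H` with finite (spectral) enstrophy `‖∇v‖² = Torus.eGradNormSq v < ∞` we prove
the form bound

  `∫ (v ⊗ v) : ∇f_GP = Torus.inertialPairing v f_GP ≥ -(√2/(4π)) ‖∇v‖²`.

Proof ("parity of `|k|²`", entirely on the Fourier side).
* Pointwise `⟪∇f_GP(x) u, u⟫ = 2π Σⱼ cos(2πxⱼ) uⱼ uⱼ₊₁` (`GPStatisticalRigidity.gpForce_fderiv_apply`).
* One-shift Parseval: for real `g, h ∈ L²(T³)`, `∫ cos(2πxⱼ) g h = Σₖ Re(conj ĝ(k − eⱼ) ĥ(k))`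
  (`Torus.mFourierCoeff_mFourier_smul`: `𝓕(eⱼ • g)(k) = ĝ(k − eⱼ)`, and the polarised Parseval
  identity `Torus.hasSum_conj_mul_mFourierCoeff`).
* Parity weights `W(k) = √2` if `|k|² = Σ kᵢ²` is even, `1/√2` if odd: since `|k − eⱼ|² = |k|² − 2kⱼ + 1`
  has the opposite parity, `W(k − eⱼ) W(k) = 1`, so termwise weighted AM–GM gives
  `Re(conj ĝ(k − eⱼ) ĥ(k)) ≥ −(W(k−eⱼ)|ĝ(k−eⱼ)|² + W(k)|ĥ(k)|²)/2`; summing (and re-indexing the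
  first sum) `∫ cos(2πxⱼ) g h ≥ −½ (Σ W|ĝ|² + Σ W|ĥ|²)`, whence `I(v) ≥ −2π Σₖ W(k) ‖v̂(k)‖²`.
* `W(k) ≤ |k|²/√2` for `k ≠ 0` (odd `|k|² ≥ 1`, even nonzero `|k|² ≥ 2`) and `v̂(0) = 0` on `H`
  (`Torus.mFourierCoeff_complexify_coe_zero_of_mem`), so
  `2π Σ W ‖v̂‖² ≤ √2 π Σ |k|² ‖v̂(k)‖² = (√2/(4π)) ‖∇v‖²` (`Torus.eGradNormSq_eq_tsum`).

This extends the proved region of the crux from `G₁ < 3π` to `G₁ < 3√2·π`. References: FMRT 2001,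
Ch. IV (the form `b`); Grafakos 2014, Prop. 3.2.7 (3) (Parseval on `Tⁿ`).
-/

-- `Summit.<Summit>.<Problem>` is the tree's mandated summit-side namespace (CONVENTIONS §2); single-conjunct summit, duplicate deliberate.
set_option linter.dupNamespace false

noncomputable section

namespace Summit.AnomalousDissipation.AnomalousDissipation.Theorems.EnsembleRigidity.GPTameDefectFloor

open MeasureTheory Filter Topology UnitAddTorus
open scoped InnerProductSpace RealInnerProductSpace ENNReal NNReal
open Literature.Analysis.FunctionSpaces Literature.Analysis.FluidPDE
open Summit.AnomalousDissipation.AnomalousDissipation.Theorems.EnsembleRigidity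

/-- Local notation: real vector fields on `T³`. -/
local notation "Vec3" => (UnitAddTorus (Fin 3)) → (EuclideanSpace ℝ (Fin 3))
/-- Local notation: `L²(T³; ℝ³)`. -/
local notation "L2" => (Lp (EuclideanSpace ℝ (Fin 3)) 2 (volume : Measure (UnitAddTorus (Fin 3))))
/-- Local notation: the energy space `H`. -/
local notation "H3" => (Torus.energySpace (Fin 3))

/-! ## Arithmetic: weighted AM–GM and the parity weight -/

/-- Weighted AM–GM behind the parity bound: for complex `a`, `b` and weights `p > 0`, `q` with
`p q = 1`, `Re(conj(a) b) ≥ -(p |a|² + q |b|²)/2`. [folklore] -/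
theorem parity_re_conj_mul_ge (a b : ℂ) {p q : ℝ} (hp : 0 < p) (hpq : p * q = 1) :
    -((p * ‖a‖ ^ 2 + q * ‖b‖ ^ 2) / 2) ≤ (starRingEnd ℂ a * b).re := by
  have h1 : -(‖a‖ * ‖b‖) ≤ (starRingEnd ℂ a * b).re := by
    have h := Complex.abs_re_le_norm (starRingEnd ℂ a * b)
    rw [norm_mul, Complex.norm_conj] at h
    exact (abs_le.1 h).1
  have key : p * (p * ‖a‖ ^ 2 + q * ‖b‖ ^ 2 - 2 * (‖a‖ * ‖b‖)) = (p * ‖a‖ - ‖b‖) ^ 2 := by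
    linear_combination (‖b‖ ^ 2) * hpq
  have h2 : 0 ≤ p * ‖a‖ ^ 2 + q * ‖b‖ ^ 2 - 2 * (‖a‖ * ‖b‖) := by
    by_contra h
    have h3 : p * (p * ‖a‖ ^ 2 + q * ‖b‖ ^ 2 - 2 * (‖a‖ * ‖b‖)) < 0 :=
      mul_neg_of_pos_of_neg hp (not_le.1 h)
    rw [key] at h3
    exact absurd h3 (not_lt.2 (sq_nonneg _))
  linarith

/-- **The parity weight.** There is `W : ℤ³ → (0, 2]` (namely `W(k) = √2` if `|k|²` is even and
`1/√2` if it is odd) with `W(k - eⱼ) W(k) = 1` for all `k`, `j` (a unit shift flips the parity of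
`|k|² = Σ kᵢ²`, as `|k - eⱼ|² = |k|² - 2kⱼ + 1`) and `√2 W(k) ≤ |k|²` for `k ≠ 0` (odd `|k|² ≥ 1`,
even nonzero `|k|² ≥ 2`). [folklore] -/
theorem parity_weight_exists : ∃ W : (Fin 3 → ℤ) → ℝ, (∀ k, 0 < W k) ∧ (∀ k, W k ≤ 2) ∧
    (∀ (k : Fin 3 → ℤ) (j : Fin 3), W (k - Pi.single j 1) * W k = 1) ∧
    (∀ k : Fin 3 → ℤ, k ≠ 0 → Real.sqrt 2 * W k ≤ Torus.freqNormSq k) := by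
  have hcast : ∀ k : Fin 3 → ℤ, ((∑ i, k i ^ 2 : ℤ) : ℝ) = Torus.freqNormSq k := fun k => by
    simp [Torus.freqNormSq]
  have hshift : ∀ (k : Fin 3 → ℤ) (j : Fin 3),
      (∑ i, (k - Pi.single j (1 : ℤ) : Fin 3 → ℤ) i ^ 2 : ℤ) = (∑ i, k i ^ 2) - 2 * k j + 1 := by
    intro k j
    fin_cases j <;> simp [Fin.sum_univ_three, Pi.single_apply] <;> ring
  have hpar : ∀ (k : Fin 3 → ℤ) (j : Fin 3),
      Even (∑ i, (k - Pi.single j (1 : ℤ) : Fin 3 → ℤ) i ^ 2 : ℤ) ↔ ¬ Even (∑ i, k i ^ 2 : ℤ) := by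
    intro k j
    rw [hshift, Int.even_iff, Int.even_iff]
    omega
  have hpos : ∀ k : Fin 3 → ℤ, k ≠ 0 → (1 : ℤ) ≤ ∑ i, k i ^ 2 := by
    intro k hk
    have h := Torus.one_le_freqNormSq hk
    rw [← hcast k] at h
    exact_mod_cast h
  have hs0 : 0 < Real.sqrt 2 := Real.sqrt_pos.2 two_pos
  have hs2 : Real.sqrt 2 * Real.sqrt 2 = 2 := Real.mul_self_sqrt zero_le_two
  have hs1 : 1 ≤ Real.sqrt 2 := Real.one_le_sqrt.2 (by norm_num)
  refine ⟨fun k => if Even (∑ i, k i ^ 2 : ℤ) then Real.sqrt 2 else (Real.sqrt 2)⁻¹,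
    fun k => ?_, fun k => ?_, fun k j => ?_, fun k hk => ?_⟩
  · dsimp only
    split_ifs <;> positivity
  · dsimp only
    split_ifs
    · nlinarith
    · exact (inv_le_one_of_one_le₀ hs1).trans one_le_two
  · dsimp only
    rw [if_congr (hpar k j) rfl rfl]
    by_cases h : Even (∑ i, k i ^ 2 : ℤ)
    · rw [if_neg (not_not.2 h), if_pos h, inv_mul_cancel₀ hs0.ne']
    · rw [if_pos h, if_neg h, mul_inv_cancel₀ hs0.ne']
  · dsimp only
    rw [← hcast k]
    have h1 := hpos k hk
    by_cases h : Even (∑ i, k i ^ 2 : ℤ)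
    · rw [if_pos h, hs2]
      have h2 : (2 : ℤ) ≤ ∑ i, k i ^ 2 := by
        rw [Int.even_iff] at h
        omega
      exact_mod_cast h2
    · rw [if_neg h, mul_inv_cancel₀ hs0.ne']
      exact_mod_cast h1

/-! ## The one-shift Parseval bound for a cosine-weighted product -/

/-- `x ↦ cos(2πxⱼ) g(x) h(x)` is integrable for real `g, h ∈ L²(T³)`. [folklore] -/
theorem parity_integrable_cos_mul_mul {g h : UnitAddTorus (Fin 3) → ℝ} (hg : MemLp g 2 volume)
    (hh : MemLp h 2 volume) (e : Fin 3 → ℤ) :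
    Integrable (fun x => (mFourier e x).re * (g x * h x)) volume := by
  have hgh : Integrable (g * h) volume := hg.integrable_mul hh
  refine hgh.bdd_mul (c := 1) (Complex.continuous_re.comp (mFourier e).continuous).aestronglyMeasurable
    (ae_of_all _ fun x => ?_)
  rw [Real.norm_eq_abs]
  exact (Complex.abs_re_le_norm _).trans (((mFourier e).norm_coe_le_norm x).trans_eq mFourier_norm)

/-- **One-shift Parseval with parity weights.** For a weight `W > 0` with `W(k - eⱼ) W(k) = 1` and
real `g, h ∈ L²(T³)` with `Σₖ W(k)|ĝ(k)|² = S_g`, `Σₖ W(k)|ĥ(k)|² = S_h`: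
`∫ cos(2πxⱼ) g h ≥ -(S_g + S_h)/2`. Indeed `∫ cos(2πxⱼ) g h = Re ∫ conj(eⱼ g) h = Σₖ Re(conj ĝ(k-eⱼ) ĥ(k))`
(polarised Parseval for `(eⱼ g, h)` and `𝓕(eⱼ g)(k) = ĝ(k - eⱼ)`), and termwise weighted AM–GM
with the weights `W(k - eⱼ)`, `W(k)` of product one. [folklore] -/
theorem parity_integral_cos_mul_mul_ge (W : (Fin 3 → ℤ) → ℝ) (hW0 : ∀ k, 0 < W k)
    (hW1 : ∀ (k : Fin 3 → ℤ) (j : Fin 3), W (k - Pi.single j 1) * W k = 1)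
    {g h : UnitAddTorus (Fin 3) → ℝ} (hg : MemLp g 2 volume) (hh : MemLp h 2 volume) {Sg Sh : ℝ}
    (hSg : HasSum (fun k => W k * ‖mFourierCoeff (fun x => (g x : ℂ)) k‖ ^ 2) Sg)
    (hSh : HasSum (fun k => W k * ‖mFourierCoeff (fun x => (h x : ℂ)) k‖ ^ 2) Sh) (j : Fin 3) :
    -((Sg + Sh) / 2) ≤ ∫ x, (mFourier (Pi.single j (1 : ℤ)) x).re * (g x * h x) := by
  have hGm : MemLp (fun x => (g x : ℂ)) 2 volume := Complex.ofRealCLM.comp_memLp' hg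
  have hHm : MemLp (fun x => (h x : ℂ)) 2 volume := Complex.ofRealCLM.comp_memLp' hh
  -- the modulated function `eⱼ • g`
  have hMm : MemLp (fun x => mFourier (Pi.single j (1 : ℤ)) x • (g x : ℂ)) 2 volume := by
    refine hGm.of_le ((mFourier _).continuous.aestronglyMeasurable.smul hGm.1)
      (ae_of_all _ fun x => ?_)
    rw [norm_smul]
    calc ‖mFourier (Pi.single j (1 : ℤ)) x‖ * ‖(g x : ℂ)‖ ≤ 1 * ‖(g x : ℂ)‖ :=
          mul_le_mul_of_nonneg_right
            (((mFourier _).norm_coe_le_norm x).trans_eq mFourier_norm) (norm_nonneg _)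
      _ = ‖(g x : ℂ)‖ := one_mul _
  -- polarised Parseval for `(eⱼ • g, h)` with the shifted coefficients, real parts
  have hP := Torus.hasSum_conj_mul_mFourierCoeff hMm hHm
  simp only [Torus.mFourierCoeff_mFourier_smul] at hP
  have hR := Complex.hasSum_re hP
  -- the integral is the real part of `∫ conj(eⱼ g) h`
  have hptw : ∀ x, starRingEnd ℂ (mFourier (Pi.single j (1 : ℤ)) x • (g x : ℂ)) * (h x : ℂ) =
      mFourier (-Pi.single j (1 : ℤ)) x * ((g * h) x : ℂ) := fun x => by
    simp only [mFourier_neg, smul_eq_mul, map_mul, Complex.conj_ofReal, Pi.mul_apply,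
      Complex.ofReal_mul]
    ring
  have hint : Integrable (fun x => mFourier (-Pi.single j (1 : ℤ)) x * ((g * h) x : ℂ)) volume :=
    (hg.integrable_mul hh).ofReal.bdd_mul (c := 1) (mFourier _).continuous.aestronglyMeasurable
      (ae_of_all _ fun x => ((mFourier _).norm_coe_le_norm x).trans_eq mFourier_norm)
  have hval : (∫ x, starRingEnd ℂ (mFourier (Pi.single j (1 : ℤ)) x • (g x : ℂ)) * (h x : ℂ)).re =
      ∫ x, (mFourier (Pi.single j (1 : ℤ)) x).re * (g x * h x) := by
    simp_rw [hptw]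
    have h1 := integral_re hint
    simp only [RCLike.re_to_complex] at h1
    rw [← h1]
    refine integral_congr_ae (ae_of_all _ fun x => ?_)
    simp [mFourier_neg, Complex.mul_re]
  rw [hval] at hR
  -- the lower series: re-index the `g`-sum by the shift `k ↦ k - eⱼ`
  have hSg' : HasSum (fun k : Fin 3 → ℤ => W (k - Pi.single j 1) *
      ‖mFourierCoeff (fun x => (g x : ℂ)) (k - Pi.single j 1)‖ ^ 2) Sg := by
    have h0 := (Equiv.subRight (Pi.single j (1 : ℤ))).hasSum_iff.2 hSg
    simpa only [Function.comp_def, Equiv.subRight_apply] using h0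
  have hF := ((hSg'.add hSh).div_const 2).neg
  exact hasSum_le (fun k => parity_re_conj_mul_ge _ _ (hW0 _) (hW1 k j)) hF hR

/-! ## The pairing against `f_GP` through the components -/

/-- `⟪∇f_GP(x) u, u⟫ = 2π (cos(2πx₂) u₂u₀ + cos(2πx₀) u₀u₁ + cos(2πx₁) u₁u₂)`. [folklore] -/
theorem parity_inner_fderiv_gpForce (x : UnitAddTorus (Fin 3)) (u : EuclideanSpace ℝ (Fin 3)) :
    ⟪Torus.fderiv gpForce x u, u⟫_ℝ = 2 * Real.pi *
      ((mFourier (Pi.single (2 : Fin 3) (1 : ℤ)) x).re * (u 2 * u 0) +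
        (mFourier (Pi.single (0 : Fin 3) (1 : ℤ)) x).re * (u 0 * u 1) +
        (mFourier (Pi.single (1 : Fin 3) (1 : ℤ)) x).re * (u 1 * u 2)) := by
  rw [GPStatisticalRigidity.gpForce_fderiv_apply]
  simp only [Torus.stokesMode_apply, inner_add_left, real_inner_smul_left,
    EuclideanSpace.inner_single_left]
  simp only [if_true, map_one, one_mul]
  ring

/-- **Step A.** For `u ∈ L²(T³; ℝ³)` and a parity weight `W`, with `Sᵢ = Σₖ W(k) |ûᵢ(k)|²`:
`∫ ⟪∇f_GP u, u⟫ ≥ -2π (S₀ + S₁ + S₂)` (the three cosine-weighted products, each bounded by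
`parity_integral_cos_mul_mul_ge`). [folklore] -/
theorem parity_pairing_ge (W : (Fin 3 → ℤ) → ℝ) (hW0 : ∀ k, 0 < W k)
    (hW1 : ∀ (k : Fin 3 → ℤ) (j : Fin 3), W (k - Pi.single j 1) * W k = 1)
    {u : Vec3} (hu : MemLp u 2 volume) {S : Fin 3 → ℝ}
    (hS : ∀ i, HasSum (fun k => W k * ‖mFourierCoeff (fun x => (u x i : ℂ)) k‖ ^ 2) (S i)) :
    -(2 * Real.pi * (S 0 + S 1 + S 2)) ≤ ∫ x, ⟪Torus.fderiv gpForce x (u x), u x⟫_ℝ := by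
  have huc : ∀ i : Fin 3, MemLp (fun x => u x i) 2 volume := fun i => hu.eval_piLp i
  have h20 := parity_integral_cos_mul_mul_ge W hW0 hW1 (huc 2) (huc 0) (hS 2) (hS 0) 2
  have h01 := parity_integral_cos_mul_mul_ge W hW0 hW1 (huc 0) (huc 1) (hS 0) (hS 1) 0
  have h12 := parity_integral_cos_mul_mul_ge W hW0 hW1 (huc 1) (huc 2) (hS 1) (hS 2) 1
  have i20 := parity_integrable_cos_mul_mul (huc 2) (huc 0) (Pi.single (2 : Fin 3) (1 : ℤ))
  have i01 := parity_integrable_cos_mul_mul (huc 0) (huc 1) (Pi.single (0 : Fin 3) (1 : ℤ))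
  have i12 := parity_integrable_cos_mul_mul (huc 1) (huc 2) (Pi.single (1 : Fin 3) (1 : ℤ))
  have i2001 : Integrable (fun x =>
      (mFourier (Pi.single (2 : Fin 3) (1 : ℤ)) x).re * (u x 2 * u x 0) +
        (mFourier (Pi.single (0 : Fin 3) (1 : ℤ)) x).re * (u x 0 * u x 1)) volume := i20.add i01
  simp_rw [parity_inner_fderiv_gpForce]
  rw [integral_const_mul, integral_add i2001 i12, integral_add i20 i01]
  have hπ : 0 < Real.pi := Real.pi_pos
  nlinarith

/-- **Step B.** For `u ∈ L²(T³; ℝ³)` with vanishing zero mode and finite enstrophy, and a weight with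
`√2 W(k) ≤ |k|²` off the origin: `2π (S₀ + S₁ + S₂) ≤ (√2/(4π)) ‖∇u‖²`, where
`Sᵢ = Σₖ W(k) |ûᵢ(k)|²` (so `Σᵢ Sᵢ = Σₖ W(k) ‖û(k)‖²`) and `‖∇u‖² = 4π² Σₖ |k|² ‖û(k)‖²`
(`Torus.eGradNormSq_eq_tsum`). [folklore] -/
theorem parity_weighted_sum_le (W : (Fin 3 → ℤ) → ℝ)
    (hWn : ∀ k : Fin 3 → ℤ, k ≠ 0 → Real.sqrt 2 * W k ≤ Torus.freqNormSq k)
    {u : Vec3} (hu : MemLp u 2 volume)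
    (hU0 : mFourierCoeff (EuclideanSpace.complexify ∘ u) 0 = 0)
    (hfin : Torus.eGradNormSq u ≠ ⊤) {S : Fin 3 → ℝ}
    (hS : ∀ i, HasSum (fun k => W k * ‖mFourierCoeff (fun x => (u x i : ℂ)) k‖ ^ 2) (S i)) :
    2 * Real.pi * (S 0 + S 1 + S 2) ≤ Real.sqrt 2 / (4 * Real.pi) * (Torus.eGradNormSq u).toReal := by
  have hπ : 0 < Real.pi := Real.pi_pos
  have hui : Integrable u volume := hu.integrable one_le_two
  have hnormU : ∀ k, ‖mFourierCoeff (EuclideanSpace.complexify ∘ u) k‖ ^ 2 =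
      ‖mFourierCoeff (fun x => (u x 0 : ℂ)) k‖ ^ 2 + ‖mFourierCoeff (fun x => (u x 1 : ℂ)) k‖ ^ 2 +
        ‖mFourierCoeff (fun x => (u x 2 : ℂ)) k‖ ^ 2 := fun k => by
    rw [EuclideanSpace.norm_sq_eq, Fin.sum_univ_three, Torus.mFourierCoeff_complexify_apply hui,
      Torus.mFourierCoeff_complexify_apply hui, Torus.mFourierCoeff_complexify_apply hui]
  -- the weighted series of the field
  have hSU : HasSum (fun k => Real.sqrt 2 * (W k * ‖mFourierCoeff (EuclideanSpace.complexify ∘ u) k‖ ^ 2))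
      (Real.sqrt 2 * (S 0 + S 1 + S 2)) := by
    have h := (((hS 0).add (hS 1)).add (hS 2)).mul_left (Real.sqrt 2)
    refine h.congr_fun fun k => ?_
    rw [hnormU]
    ring
  -- the enstrophy series, in `ℝ`
  have hterm : ∀ k : Fin 3 → ℤ, ENNReal.ofReal (Torus.freqNormSq k) *
      ‖mFourierCoeff (EuclideanSpace.complexify ∘ u) k‖ₑ ^ 2 ≠ ⊤ := fun k =>
    ENNReal.mul_ne_top ENNReal.ofReal_ne_top (ENNReal.pow_ne_top enorm_ne_top)
  have htermR : ∀ k : Fin 3 → ℤ, (ENNReal.ofReal (Torus.freqNormSq k) *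
      ‖mFourierCoeff (EuclideanSpace.complexify ∘ u) k‖ₑ ^ 2).toReal =
      Torus.freqNormSq k * ‖mFourierCoeff (EuclideanSpace.complexify ∘ u) k‖ ^ 2 := fun k => by
    rw [ENNReal.toReal_mul, ENNReal.toReal_ofReal (Torus.freqNormSq_nonneg k), ENNReal.toReal_pow,
      toReal_enorm]
  have hT : ∑' k : Fin 3 → ℤ, ENNReal.ofReal (Torus.freqNormSq k) *
      ‖mFourierCoeff (EuclideanSpace.complexify ∘ u) k‖ₑ ^ 2 ≠ ⊤ := by
    intro hT
    apply hfin
    rw [Torus.eGradNormSq_eq_tsum, hT, ENNReal.mul_top (ENNReal.ofReal_pos.2 (by positivity)).ne']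
  have hGsum : HasSum (fun k => Torus.freqNormSq k * ‖mFourierCoeff (EuclideanSpace.complexify ∘ u) k‖ ^ 2)
      ((Torus.eGradNormSq u).toReal / (4 * Real.pi ^ 2)) := by
    have h1 : (Torus.eGradNormSq u).toReal / (4 * Real.pi ^ 2) =
        ∑' k, Torus.freqNormSq k * ‖mFourierCoeff (EuclideanSpace.complexify ∘ u) k‖ ^ 2 := by
      rw [Torus.eGradNormSq_eq_tsum, ENNReal.toReal_mul, ENNReal.toReal_ofReal (by positivity),
        ENNReal.tsum_toReal_eq hterm]
      simp_rw [htermR]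
      rw [mul_div_cancel_left₀ _ (by positivity)]
    rw [h1]
    exact ((ENNReal.summable_toReal hT).congr htermR).hasSum
  have hcmp : ∀ k, Real.sqrt 2 * (W k * ‖mFourierCoeff (EuclideanSpace.complexify ∘ u) k‖ ^ 2) ≤
      Torus.freqNormSq k * ‖mFourierCoeff (EuclideanSpace.complexify ∘ u) k‖ ^ 2 := fun k => by
    by_cases hk : k = 0
    · subst hk
      rw [hU0]
      simp
    · rw [← mul_assoc]
      exact mul_le_mul_of_nonneg_right (hWn k hk) (sq_nonneg _)
  have hB0 := hasSum_le hcmp hSU hGsum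
  have hs2 : Real.sqrt 2 * Real.sqrt 2 = 2 := Real.mul_self_sqrt zero_le_two
  have h1 := mul_le_mul_of_nonneg_left hB0 (Real.sqrt_nonneg 2)
  rw [← mul_assoc, hs2] at h1
  have h2 := mul_le_mul_of_nonneg_left h1 hπ.le
  calc 2 * Real.pi * (S 0 + S 1 + S 2) = Real.pi * (2 * (S 0 + S 1 + S 2)) := by ring
    _ ≤ Real.pi * (Real.sqrt 2 * ((Torus.eGradNormSq u).toReal / (4 * Real.pi ^ 2))) := h2
    _ = Real.sqrt 2 / (4 * Real.pi) * (Torus.eGradNormSq u).toReal := by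
        field_simp

/-- **The parity bound on `L²` fields with vanishing zero mode**: for `u ∈ L²(T³; ℝ³)` with
`û(0) = 0` and `‖∇u‖² < ∞`, `∫ ⟪∇f_GP u, u⟫ ≥ -(√2/(4π)) ‖∇u‖²`. [folklore] -/
theorem parity_pairing_ge_enstrophy {u : Vec3} (hu : MemLp u 2 volume)
    (hU0 : mFourierCoeff (EuclideanSpace.complexify ∘ u) 0 = 0) (hfin : Torus.eGradNormSq u ≠ ⊤) :
    -(Real.sqrt 2 / (4 * Real.pi) * (Torus.eGradNormSq u).toReal) ≤
      ∫ x, ⟪Torus.fderiv gpForce x (u x), u x⟫_ℝ := by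
  obtain ⟨W, hW0, hW2, hW1, hWn⟩ := parity_weight_exists
  have hsum : ∀ i : Fin 3, Summable (fun k => W k * ‖mFourierCoeff (fun x => (u x i : ℂ)) k‖ ^ 2) :=
    fun i => Summable.of_nonneg_of_le (fun k => mul_nonneg (hW0 k).le (sq_nonneg _))
      (fun k => mul_le_mul_of_nonneg_right (hW2 k) (sq_nonneg _))
      ((Torus.hasSum_sq_norm_mFourierCoeff (Torus.memLp_ofReal_apply hu i)).summable.mul_left 2)
  obtain ⟨S, hS⟩ : ∃ S : Fin 3 → ℝ,
      ∀ i, HasSum (fun k => W k * ‖mFourierCoeff (fun x => (u x i : ℂ)) k‖ ^ 2) (S i) :=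
    ⟨fun i => ∑' k, W k * ‖mFourierCoeff (fun x => (u x i : ℂ)) k‖ ^ 2, fun i => (hsum i).hasSum⟩
  have hA := parity_pairing_ge W hW0 hW1 hu hS
  have hB := parity_weighted_sum_le W hWn hu hU0 hfin hS
  linarith

/-! ## The stub -/

/-- **Stub `stub_gpParityForm`** (card `ground-state-jump`, L1′) — PARITY OF `|k|²`. For every `v` in
the energy space `H` of `T³` with finite enstrophy, `∫ (v ⊗ v) : ∇f_GP ≥ -(√2/(4π)) ‖∇v‖²`: the
strain of `f_GP` is multiplication by `cos 2πxⱼ`, which shifts Fourier modes by `±eⱼ` and flips the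
parity of `|k|²`; weighting the modes of even / odd `|k|²` by `√2` / `1/√2` in the termwise AM–GM and
using `|k|² ≥ 2` on even nonzero modes gives the constant `√2/(4π)`. [folklore] -/
theorem stub_gpParityForm : ∀ v : H3, Torus.eGradNormSq ((v : L2) : Vec3) ≠ ⊤ → -(Real.sqrt 2 / (4 * Real.pi) * (Torus.eGradNormSq ((v : L2) : Vec3)).toReal) ≤ Torus.inertialPairing (v : L2) gpForce := by
  intro v hv
  rw [Torus.inertialPairing]
  exact parity_pairing_ge_enstrophy (Lp.memLp (v : L2))
    (Torus.mFourierCoeff_complexify_coe_zero_of_mem v.2) hv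

end Summit.AnomalousDissipation.AnomalousDissipation.Theorems.EnsembleRigidity.GPTameDefectFloor

end
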